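import Literature.MathematicalPhysics.QuantumFieldTheory.Balaban1983to89.B4Thm110BoxWalk
import Literature.MathematicalPhysics.QuantumFieldTheory.Balaban1983to89.B4RegionCubeCarrier

/-!
# `Balaban1983to89.B4Thm110BoxCut` — [Balaban1983RegularityDecay] THEOREM p. 573, (1.10) value member, ON A BOX `Ω`
# WITH THE PRINT's CUT CUBES `□_j = Ω ∩ (2M-cube of centre Mj)` (p. 575) AS THE PER-CUBE CARRIERS — the walk route
# `B4Ineq110WalkRoute.ineq110_value_apply` assembled with `S_j := □_j`, `G_j := pad(G_k(□_j, Ã_j)) + cinv`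
# (`B4CubeGreenBox.cubeGreen`), per-cube inputs = Lemma 2.2 / (2.20) ON THE SUB-BOXES (sides `K` or `2K`)

statement-level skeleton of published theorems with citation tags; proofs where landed; nothing here is a claim about the Yang–Mills mass gap

CITATION HEADER.  T. Bałaban, *Regularity and decay of lattice Green's functions*, Commun. Math. Phys. **89** (1983)
571–597, doi:10.1007/bf01214744 [Balaban1983RegularityDecay] (cell paper B4; held text
`paper:balaban1983-cmp89-regularity-decay`, journal page = PDF page + 570; pp. 573, 575–579).  Unit `lit-balaban-p17`
gen 5 (Phase-2 proof seat p17; HOME `run/shared/lean/pub/lit-balaban/`), SKELETON rows **B4.Thm@573** (Theorem p. 573,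
(1.10) value member, rectangular `Ω`), **B4.Eq2.2** (`G₀ = Σ_j h_jG_k(□_j,Ã_j)h_j` with the CUT cubes), **B4.Eq2.18**.
Imports p17 g4 `B4Thm110BoxWalk` (→ `B4BoxCubeGeometry`: `posR`, `cubeLo/cubeMs/cubeS`, `cubeS_of_near`, `boxWt_local`,
`blkWt_local`, `contourTrans_plateau`; `plateau_fine`) and r01 g7 `B4RegionCubeCarrier` (→ p17 g4 `B4CubeGreenBox`:
`cubeW/cubeT/cubeGreen`, `cubeOp_mul_cubeGreen`, `norm_cubeGreen_le`, `cube_letter_b`; translation lemmas `hZ_add`,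
`thetaZ_add`, `compField_add`, `constBond_add`).

WHY THIS FILE (versus p17 g4's `B4Thm110BoxWalk.thm110_value_box`).  Gen 4 assembled the walk route on a box with the cube
predicate `S_j := Ω` and `G_j := G_k(Ω, Ã_j)` («Option U»): valid for (1.9)/(1.10), but (a) the per-cube inputs then live on
the WHOLE box, so p35's threshold «e sufficiently small» inherited the box-size bound `S` (`e₁ = e₁(c,β,S)` in
`B4Thm110BoxRegular`; print p. 573: constants «independent of A, k, Ω»), and (b) the print's proof of the `δG` clause
(1.11)–(1.12) (p. 579 «The terms with ω such that □_{ω_i} are interior cubes of Ω are the same in both representations,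
so they cancel») needs the per-cube propagators to be the Green's functions OF THE CUT CUBES, the same operator for `Ω`
and `Ω₀`.  This file re-assembles the value member of (1.10) with the print's own cut cubes: p. 575 «□_j = Ω ∩ {a sum of
large blocks for which the point Mj is one of the vertices}. … if the point Mj is not a boundary point of Ω, then □_j is a
cube of the size 2M and with center in Mj. For Mj lying on the boundary the set □_j is a sum of several (≤ 2^d) large
blocks»; on a box `Ω = Π[0, nMb_μ)` (`K ∣ Mb_μ`, the print's `M` = our `K`) every `□_j` is a sub-box of sides `K` or `2K`
(`cubeMs_eq`), so the per-cube inputs are statements about `G_k(□, Ã)` on boxes of sides `≤ 2K` — uniform in `Ω`.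

WHAT THIS MODULE PROVES (all in full; `Ω = Box d ℓ k Mb`, `n = (ℓ+1)^k`, `d ≥ 1`).
* §1 `labelsK Mb K` (labels `0 ≤ j_μ ≤ Mb_μ/K` of the cubes meeting `Ω`), `mem_labelsK_of_hCube_ne_zero` (`hs` of the walk
  route), `jloc j` (the label of `□_j` seen on its own sub-box: `1` in interior directions, `0` at a lower face), and the
  closed forms `cubeLo_eq` (`cubeLo = K(j − jloc j)`), `cubeMs_eq` (`2K` in interior directions, `K` at the faces),
  `one_le_cubeMs`, `dvd_cubeMs`, `cubeMs_le`, `cubeMs_interior`.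
* §2 `hCube_subEmb` — the walk route's `h_j` restricted to `□_j` is the lineage's `hBox n K (cubeMs j) (jloc j)` on the
  sub-box (`B4RegionCubeCarrier.hZ_add`).
* §3 **`thm110_value_boxCut`** — THEOREM (1.10), value member, on `Ω` for an ARBITRARY bond field `A` and ARBITRARY cube
  configurations `Ã_j` agreeing with `A` on the plateaus, from per-cube inputs ON THE SUB-BOXES in p35's vocabulary:
  `‖G_k(□_j, Ã_j|□_j)Φ‖_∞ ≤ c_G‖Φ‖_∞` (Lemma 2.2 (2.17)) and `‖K_{h_j}G_k(□_j, Ã_j|□_j)h_jΦ‖_∞ ≤ c_K‖Φ‖_∞` ((2.20)) for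
  `j ∈ labelsK`, and `3^{d+1}√N c_K ≤ e^{−1}` ((2.21)–(2.22)); conclusion
  `|(G_k(Ω,A)f)(x)_i| ≤ 2^{d+2}e^{9/4}·max(√N c_G, 2)·e^{−D/K}·‖f‖_∞` for `f` supported at sup-distance `≥ D` (unit lattice)
  from `x` — EVERY `x ∈ Ω` (print p. 573: «for rectangular parallelepipeds, the inequalities hold without any restrictions on
  the points»).
* §4 `subField_cubeField` — p35's `Ã_j = A₀ + θ_j(A − A₀)` on `Ω` restricts along `□_j` to the cube configuration
  `Ã_{jloc j}` of the translated component field on the sub-box; **`thm110_value_boxCut_cubeField`** — §3 for the component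
  field `A = compField Ac` and `Ã_j := cubeField Ω n K j (A₀ j) Ac` with an arbitrary base value `A₀ j` per label (plateau
  agreement = p35's `cubeField_eq_compField`), the inputs being about `cubeField □_j n K (jloc j) (A₀ j) (Ac ∘ (· + n·cubeLo j))`.
HONEST SCOPE.  Value member only; `d ≥ 1` (the padded inverse off the cube needs a second lattice direction,
`B4CubeGreenBox.cdeg_ge`); the lineage's (1.6) (running coefficient `a_kη^{d+1}`, staircase contours, charge `κ`); the
per-cube inputs are HYPOTHESES here (their discharge for a (1.7)-regular `A` constant near `∂Ω`, uniformly in `Ω`, is the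
sequel `B4Thm110BoxUniform`).  Definitions with bodies (`labelsK`, `jloc`) and theorems; no `Prop` fact, no `sorry`;
axioms standard.
DOCFIX 2026-08-22 (lit-balaban-p17 gen 26, on r04 g22 `CITELOC-AUDIT-g22.md` §3, verified on the text layer of [Balaban1983RegularityDecay]): citation locators only — «(2.5) p.575» → «p.575 ‹h_j(x) = h(x/M − j)› (unnumbered, before (2.2))» at two `[cite:]` tags (the partition of unity is unnumbered text on p. 575; the display (2.5) is the Leibniz formula on p. 576 and was not meant); every declaration byte-identical.
-/

namespace Literature.MathematicalPhysics.QuantumFieldTheory.Balaban1983to89.B4Thm110BoxCut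

open Literature.MathematicalPhysics.QuantumFieldTheory.Balaban1983to89.B4Reflection242 (boxDom mem_boxDom nbrs mem_nbrs blk)
open Literature.MathematicalPhysics.QuantumFieldTheory.Balaban1983to89.B4GaugeCovariance
open Literature.MathematicalPhysics.QuantumFieldTheory.Balaban1983to89.B4Commutators25to211 (mulH opK)
open Literature.MathematicalPhysics.QuantumFieldTheory.Balaban1983to89.B4Lower18Regular (e1 baseEmb stairContour)
open Literature.MathematicalPhysics.QuantumFieldTheory.Balaban1983to89.B4Lower18RegularRegion (compField)
open Literature.MathematicalPhysics.QuantumFieldTheory.Balaban1983to89.B4Lemma22ReduceZero (Box opA greenA)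
open Literature.MathematicalPhysics.QuantumFieldTheory.Balaban1983to89.B4Lemma22Reduce231 (supN supN_nonneg)
open Literature.MathematicalPhysics.QuantumFieldTheory.Balaban1983to89.B4Lemma22Invertible (opA_stair_isUnit_det)
open Literature.MathematicalPhysics.QuantumFieldTheory.Balaban1983to89.B4PartitionUnity22 (hCube hCube_ne_zero_imp)
open Literature.MathematicalPhysics.QuantumFieldTheory.Balaban1983to89.B4Eq220PartitionSizes (hZ hBox)
open Literature.MathematicalPhysics.QuantumFieldTheory.Balaban1983to89.B4Eq220CommutatorField (kOp)
open Literature.MathematicalPhysics.QuantumFieldTheory.Balaban1983to89.B4Ineq110WalkRoute (ineq110_value_apply)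
open Literature.MathematicalPhysics.QuantumFieldTheory.Balaban1983to89.B4CubeOpReindex (pad cutWt norm_pad
  linfty_opNorm_le_of_supN)
open Literature.MathematicalPhysics.QuantumFieldTheory.Balaban1983to89.B4SubBoxCarrier (subEmb subEmbY inSub inSub_iff
  subEmb_injective)
open Literature.MathematicalPhysics.QuantumFieldTheory.Balaban1983to89.B4CubeGreenBox (subField cubeW cubeT cubeGreen
  cubeOp_mul_cubeGreen norm_cubeGreen_le cube_letter_b)
open Literature.MathematicalPhysics.QuantumFieldTheory.Balaban1983to89.B4BoxCubeGeometry (posR cubeLo cubeHi cubeMs cube_ho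
  cubeS cubeS_of_near cubeS_of_plateau cubeS_of_hCube_ne_zero boxWt_local blkWt_local contourTrans_plateau)
open Literature.MathematicalPhysics.QuantumFieldTheory.Balaban1983to89.B4Thm110BoxWalk (plateau_fine)
open Literature.MathematicalPhysics.QuantumFieldTheory.Balaban1983to89.B4CubeFields22 (cubeField cubeFluct fluct thetaZ
  cubeField_eq_compField)
open Literature.MathematicalPhysics.QuantumFieldTheory.Balaban1983to89.B4RegionCubeCarrier (hZ_add thetaZ_add compField_add
  constBond_add)
open scoped Matrix
open scoped Matrix.Norms.Operator

noncomputable section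

variable {d : ℕ}

/-! ## §1. Labels of the cubes meeting `Ω`; the cut cubes in closed form -/

section Labels

variable (Mb : Fin (d + 1) → ℕ) (K : ℕ)

/-- **THE LABELS OF THE CUBES MEETING `Ω = Π[0, Mb_μ)`** (unit-lattice units, cube size `K`): `0 ≤ j_μ ≤ Mb_μ/K`
(cube centres `Kj` at the vertices of the large blocks of `Ω`, boundary vertices included).
[cite: Balaban1983RegularityDecay, §2 p.575 «For each j ∈ Z^d, let us define the set □_j», dictionary] -/
def labelsK : Finset (Fin (d + 1) → ℤ) := Fintype.piFinset fun μ => Finset.Icc (0 : ℤ) ((Mb μ / K : ℕ) : ℤ)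

/-- **THE LABEL OF `□_j` ON ITS OWN SUB-BOX**: after translating `□_j` to the origin the centre `Kj` becomes `K·jloc j`,
`jloc j_μ = 1` in an interior direction (`j_μ ≥ 1`: the sub-box starts at `K(j_μ − 1)`), `= 0` at a lower face (`j_μ = 0`).
[cite: Balaban1983RegularityDecay, §2 p.575 «□_j is a cube of the size 2M and with center in Mj», dictionary] -/
def jloc (j : Fin (d + 1) → ℤ) : Fin (d + 1) → ℤ := fun μ => if 1 ≤ j μ then 1 else 0

variable {Mb K}

/-- membership in `labelsK`. [cite: Balaban1983RegularityDecay, §2 p.575, dictionary] -/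
theorem mem_labelsK_iff {j : Fin (d + 1) → ℤ} :
    j ∈ labelsK Mb K ↔ ∀ μ, 0 ≤ j μ ∧ j μ ≤ ((Mb μ / K : ℕ) : ℤ) := by
  simp only [labelsK, Fintype.mem_piFinset, Finset.mem_Icc]

/-- **`hs` OF THE WALK ROUTE, SHARP FORM**: a cube whose `h_j` does not vanish somewhere on `Ω` has `0 ≤ j_μ ≤ Mb_μ/K`
(`K ∣ Mb_μ`; the support of `h_j` is the open ⅝-box of centre `Kj`). [cite: Balaban1983RegularityDecay, p.575 «h_j(x) = h(x/M − j)», h ∈ C₀^∞(]−⅝, ⅝[) (unnumbered, before (2.2))] -/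
theorem mem_labelsK_of_hCube_ne_zero {ℓ k : ℕ} (hK : 1 ≤ K) (hKM : ∀ μ, K ∣ Mb μ) (j : Fin (d + 1) → ℤ)
    (x : ↥(Box d ℓ k Mb)) (h : hCube (K : ℝ) j (posR ℓ k Mb x) ≠ 0) : j ∈ labelsK Mb K := by
  have hKr : (0 : ℝ) < K := by exact_mod_cast hK
  have hn : (0 : ℝ) < (((ℓ + 1) ^ k : ℕ) : ℝ) := by exact_mod_cast pow_pos (Nat.succ_pos ℓ) k
  rw [mem_labelsK_iff]
  intro μ
  have hμ := abs_lt.1 (hCube_ne_zero_imp hKr h μ)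
  rw [posR] at hμ
  have hz := (mem_boxDom.1 x.2) μ
  have hz0 : (0 : ℝ) ≤ x.1 μ := by exact_mod_cast hz.1
  have hzM : (x.1 μ : ℝ) < (((ℓ + 1) ^ k : ℕ) : ℝ) * Mb μ := by
    have h2 : x.1 μ < (((ℓ + 1) ^ k * Mb μ : ℕ) : ℤ) := hz.2
    push_cast at h2
    exact_mod_cast h2
  obtain ⟨m, hm⟩ := hKM μ
  have hmK : Mb μ / K = m := by rw [hm, Nat.mul_div_cancel_left _ (by omega)]
  have hMbr : (Mb μ : ℝ) = (K : ℝ) * m := by rw [hm]; push_cast; ring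
  have hp0 : (0 : ℝ) ≤ (x.1 μ : ℝ) / (((ℓ + 1) ^ k : ℕ) : ℝ) := div_nonneg hz0 hn.le
  have hpM : (x.1 μ : ℝ) / (((ℓ + 1) ^ k : ℕ) : ℝ) < (K : ℝ) * m := by
    rw [div_lt_iff₀ hn, ← hMbr, mul_comm]; exact hzM
  rw [hmK]
  constructor
  · have : (-1 : ℝ) < j μ := by nlinarith
    have : (-1 : ℤ) < j μ := by exact_mod_cast this
    omega
  · have : (j μ : ℝ) < m + 1 := by nlinarith
    have : j μ < (m : ℤ) + 1 := by exact_mod_cast this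
    omega

/-- the unit-lattice side is `K·(Mb_μ/K)`. [folklore] -/
private theorem Mb_eq {μ : Fin (d + 1)} (hKM : K ∣ Mb μ) : Mb μ = K * (Mb μ / K) := by
  obtain ⟨m, hm⟩ := hKM
  rcases Nat.eq_zero_or_pos K with hK | hK
  · subst hK; simp [hm]
  · rw [hm, Nat.mul_div_cancel_left _ hK]

/-- **THE CORNER OF `□_j` IN CLOSED FORM**: `cubeLo j = K(j − jloc j)` for a label of `labelsK` (`K ∣ Mb_μ`), i.e.
`K(j_μ − 1)` in an interior direction and `0` at a lower face. [cite: Balaban1983RegularityDecay, §2 p.575, dictionary] -/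
theorem cubeLo_eq (hKM : ∀ μ, K ∣ Mb μ) {j : Fin (d + 1) → ℤ} (hj : j ∈ labelsK Mb K) (μ : Fin (d + 1)) :
    ((cubeLo Mb K j μ : ℕ) : ℤ) = (K : ℤ) * (j μ - jloc j μ) := by
  obtain ⟨hj0, hjm⟩ := (mem_labelsK_iff.1 hj) μ
  have hMb : Mb μ = K * (Mb μ / K) := Mb_eq (hKM μ)
  unfold cubeLo jloc
  by_cases h1 : 1 ≤ j μ
  · rw [if_pos h1]
    have hnn : (0 : ℤ) ≤ (K : ℤ) * (j μ - 1) := mul_nonneg (Nat.cast_nonneg K) (by omega)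
    have hle : ((K : ℤ) * (j μ - 1)).toNat ≤ Mb μ := by
      rw [Int.toNat_le]
      have hMbz : ((Mb μ : ℕ) : ℤ) = (K : ℤ) * ((Mb μ / K : ℕ) : ℤ) := by exact_mod_cast hMb
      rw [hMbz]
      have : j μ - 1 ≤ ((Mb μ / K : ℕ) : ℤ) := by omega
      nlinarith [(Nat.cast_nonneg K : (0 : ℤ) ≤ K)]
    rw [min_eq_right hle, Int.toNat_of_nonneg hnn]
  · rw [if_neg h1]
    have hj00 : j μ = 0 := by omega
    have hnp : (K : ℤ) * (j μ - 1) ≤ 0 := by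
      rw [hj00]; have := (Nat.cast_nonneg K : (0 : ℤ) ≤ K); nlinarith
    rw [Int.toNat_eq_zero.mpr hnp, Nat.min_zero, hj00]
    simp

/-- **THE SIDES OF `□_j` IN CLOSED FORM**: `2K` in a direction with `1 ≤ j_μ ≤ Mb_μ/K − 1` (an interior direction), `K`
at a face (`j_μ = 0` or `j_μ = Mb_μ/K`; `Mb_μ ≥ 1`, `K ∣ Mb_μ`) — print: «if the point Mj is not a boundary point of Ω,
then □_j is a cube of the size 2M … For Mj lying on the boundary the set □_j is a sum of several (≤ 2^d) large blocks».
[cite: Balaban1983RegularityDecay, §2 p.575] -/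
theorem cubeMs_eq (hK : 1 ≤ K) (hKM : ∀ μ, K ∣ Mb μ) (hMb1 : ∀ μ, 1 ≤ Mb μ) {j : Fin (d + 1) → ℤ}
    (hj : j ∈ labelsK Mb K) (μ : Fin (d + 1)) :
    cubeMs Mb K j μ = if 1 ≤ j μ ∧ j μ + 1 ≤ ((Mb μ / K : ℕ) : ℤ) then 2 * K else K := by
  obtain ⟨hj0, hjm⟩ := (mem_labelsK_iff.1 hj) μ
  have hMb : Mb μ = K * (Mb μ / K) := Mb_eq (hKM μ)
  set m : ℕ := Mb μ / K with hm_def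
  have hm1 : 1 ≤ m := by
    by_contra hc
    have hm0 : m = 0 := by omega
    have h1 := hMb1 μ
    rw [hMb, hm0, mul_zero] at h1
    omega
  have hlo : ((cubeLo Mb K j μ : ℕ) : ℤ) = (K : ℤ) * (j μ - jloc j μ) := cubeLo_eq hKM hj μ
  -- the far corner
  have hhi : ((cubeHi Mb K j μ : ℕ) : ℤ) = min ((Mb μ : ℕ) : ℤ) ((K : ℤ) * (j μ + 1)) := by
    unfold cubeHi
    have hnn : (0 : ℤ) ≤ (K : ℤ) * (j μ + 1) := mul_nonneg (Nat.cast_nonneg K) (by omega)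
    push_cast [Nat.cast_min]
    rw [Int.toNat_of_nonneg hnn]
  have hMbz : ((Mb μ : ℕ) : ℤ) = (K : ℤ) * (m : ℤ) := by rw [hMb]; push_cast; rfl
  have hK0 : (0 : ℤ) < K := by exact_mod_cast hK
  -- compute in `ℤ`
  have key : ((cubeMs Mb K j μ : ℕ) : ℤ) = if 1 ≤ j μ ∧ j μ + 1 ≤ (m : ℤ) then 2 * (K : ℤ) else K := by
    have hsub : ((cubeMs Mb K j μ : ℕ) : ℤ) = ((cubeHi Mb K j μ : ℕ) : ℤ) - (cubeLo Mb K j μ : ℕ) := by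
      unfold cubeMs
      have hle : cubeLo Mb K j μ ≤ cubeHi Mb K j μ := by
        have h1 : ((cubeLo Mb K j μ : ℕ) : ℤ) ≤ ((cubeHi Mb K j μ : ℕ) : ℤ) := by
          rw [hlo, hhi, hMbz]
          unfold jloc
          split_ifs with h
          · refine le_min ?_ ?_ <;> nlinarith
          · refine le_min ?_ ?_ <;> nlinarith
        exact_mod_cast h1
      push_cast [Nat.cast_sub hle]
      ring
    rw [hsub, hlo, hhi, hMbz]
    unfold jloc
    by_cases h1 : 1 ≤ j μ
    · rw [if_pos h1]
      by_cases h2 : j μ + 1 ≤ (m : ℤ)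
      · rw [if_pos ⟨h1, h2⟩, min_eq_right (by nlinarith)]; ring
      · rw [if_neg (fun h => h2 h.2)]
        have hjm' : j μ = m := by omega
        rw [min_eq_left (by nlinarith), hjm']; ring
    · rw [if_neg h1, if_neg (fun h => h1 h.1)]
      have hj00 : j μ = 0 := by omega
      rw [hj00, min_eq_right (by nlinarith)]; ring
  by_cases hc : 1 ≤ j μ ∧ j μ + 1 ≤ (m : ℤ)
  · rw [if_pos hc] at key ⊢; exact_mod_cast key
  · rw [if_neg hc] at key ⊢; exact_mod_cast key

/-- `1 ≤ cubeMs j μ` (indeed `K ≤`). [cite: Balaban1983RegularityDecay, §2 p.575, dictionary] -/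
theorem one_le_cubeMs (hK : 1 ≤ K) (hKM : ∀ μ, K ∣ Mb μ) (hMb1 : ∀ μ, 1 ≤ Mb μ) {j : Fin (d + 1) → ℤ}
    (hj : j ∈ labelsK Mb K) (μ : Fin (d + 1)) : 1 ≤ cubeMs Mb K j μ := by
  rw [cubeMs_eq hK hKM hMb1 hj μ]; split_ifs <;> omega

/-- `K ∣ cubeMs j μ`. [cite: Balaban1983RegularityDecay, §2 p.575, dictionary] -/
theorem dvd_cubeMs (hK : 1 ≤ K) (hKM : ∀ μ, K ∣ Mb μ) (hMb1 : ∀ μ, 1 ≤ Mb μ) {j : Fin (d + 1) → ℤ}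
    (hj : j ∈ labelsK Mb K) (μ : Fin (d + 1)) : K ∣ cubeMs Mb K j μ := by
  rw [cubeMs_eq hK hKM hMb1 hj μ]; split_ifs
  · exact Dvd.intro_left 2 rfl
  · exact dvd_rfl

/-- `cubeMs j μ ≤ 2K`: the per-cube carriers have sides `≤ 2K`, UNIFORMLY IN `Ω`. [cite: Balaban1983RegularityDecay, §2 p.575] -/
theorem cubeMs_le (hK : 1 ≤ K) (hKM : ∀ μ, K ∣ Mb μ) (hMb1 : ∀ μ, 1 ≤ Mb μ) {j : Fin (d + 1) → ℤ}
    (hj : j ∈ labelsK Mb K) (μ : Fin (d + 1)) : cubeMs Mb K j μ ≤ 2 * K := by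
  rw [cubeMs_eq hK hKM hMb1 hj μ]; split_ifs <;> omega

/-- an INTERIOR label (`1 ≤ j_μ ≤ Mb_μ/K − 1` in every direction) has `□_j` = the full `2K`-cube: `cubeMs j = 2K`,
`jloc j = 1`, so p35's interior-cube hypotheses `1 ≤ jloc j_μ`, `K(jloc j_μ + 1) ≤ cubeMs j_μ` hold on the sub-box.
[cite: Balaban1983RegularityDecay, §2 p.575 «□_j is a cube of the size 2M and with center in Mj»] -/
theorem cubeMs_interior (hK : 1 ≤ K) (hKM : ∀ μ, K ∣ Mb μ) (hMb1 : ∀ μ, 1 ≤ Mb μ) {j : Fin (d + 1) → ℤ}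
    (hj : j ∈ labelsK Mb K) (hint : ∀ μ, 1 ≤ j μ ∧ j μ + 1 ≤ ((Mb μ / K : ℕ) : ℤ)) (μ : Fin (d + 1)) :
    cubeMs Mb K j μ = 2 * K ∧ jloc j μ = 1 := by
  rw [cubeMs_eq hK hKM hMb1 hj μ, if_pos (hint μ)]
  exact ⟨rfl, if_pos (hint μ).1⟩

end Labels

/-! ## §2. The walk route's `h_j` restricted to `□_j` -/

section Restrict

/-- **`h_j` ON THE SUB-BOX**: restricted along `subEmb` (translation by `n·cubeLo j`), the walk route's partition function
`hCube K j ∘ posR` is the lineage's `hBox n K (cubeMs j) (jloc j)` — [B4]'s `h` at the label `jloc j` of the translated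
cube. [cite: Balaban1983RegularityDecay, p.575 «h_j(x) = h(x/M − j)» (unnumbered, before (2.2))] -/
theorem hCube_subEmb {ℓ k : ℕ} {Mb : Fin (d + 1) → ℕ} {K : ℕ} (hK : 1 ≤ K) (hKM : ∀ μ, K ∣ Mb μ)
    {j : Fin (d + 1) → ℤ} (hj : j ∈ labelsK Mb K) (b : ↥(Box d ℓ k (cubeMs Mb K j))) :
    hCube (K : ℝ) j (posR ℓ k Mb (subEmb ℓ k Mb (cubeMs Mb K j) (cubeLo Mb K j) (cube_ho Mb K j) b))
      = hBox ((ℓ + 1) ^ k) K (cubeMs Mb K j) (jloc j) b := by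
  have hn : 1 ≤ (ℓ + 1) ^ k := Nat.one_le_pow _ _ (Nat.succ_pos ℓ)
  have h1 : hCube (K : ℝ) j (posR ℓ k Mb (subEmb ℓ k Mb (cubeMs Mb K j) (cubeLo Mb K j) (cube_ho Mb K j) b))
      = hZ ((ℓ + 1) ^ k) K j (b.1 + fun i => (((ℓ + 1) ^ k : ℕ) : ℤ) * (cubeLo Mb K j i : ℤ)) := rfl
  rw [h1]
  exact hZ_add hn hK (fun i => cubeLo_eq hKM hj i) b.1

end Restrict

/-! ## §3. THEOREM (1.10), value member, on a box — the walk route with the CUT cubes -/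

section Route

variable {ι : Type} [Fintype ι] [DecidableEq ι]

/-- `2/n² ≤ 2`. [folklore] -/
private theorem two_div_sq_le {n : ℕ} (hn : 1 ≤ n) : (2 : ℝ) / ((n : ℕ) : ℝ) ^ 2 ≤ 2 := by
  have h1 : (1 : ℝ) ≤ ((n : ℕ) : ℝ) ^ 2 := by
    have : (1 : ℝ) ≤ n := by exact_mod_cast hn
    nlinarith
  exact div_le_self (by norm_num) h1

/-- **THEOREM (1.10) ON A BOX `Ω`, VALUE MEMBER, WITH THE PRINT's CUT CUBES** (pp.575–579 on the lineage's carriers).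
Data: `Ω = Box d ℓ k Mb` (`L = ℓ+1 ≥ 2`, `k ≥ 1`, `n = L^k`, `d ≥ 1`, `1 ≤ Mb_μ`, `K ∣ Mb_μ`), large-cube size `K`
(`8 ≤ K`, `4 ∣ K`), `a > 0`, `m² ≥ 0`, an arbitrary bond configuration `A` on `Ω` and cube configurations `Ã_j` with
`Ã_j = A` on pairs of the plateau `{|x/n − Kj|_∞ ≤ ¾K}` (p.576).  Per-cube carriers: the CUT cubes
`□_j = Ω ∩ [K(j−1), K(j+1))^{d+1}` = the sub-boxes of corner `cubeLo j` and sides `cubeMs j ∈ {K, 2K}^{d+1}`; cube data =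
links/transporters of `Ã_j` on `□_j`, null off `□_j` (`cubeW`, `cubeT`); `G_j = pad(G_k(□_j, Ã_j|□_j)) + cinv` (`cubeGreen`).
Inputs, for every `j ∈ labelsK Mb K`, ON THE SUB-BOX: `‖G_k(□_j,Ã_j|□_j)Φ‖_∞ ≤ c_G‖Φ‖_∞` (Lemma 2.2 (2.17)) and
`‖K_{h}G_k(□_j,Ã_j|□_j)hΦ‖_∞ ≤ c_K‖Φ‖_∞` with `h = hBox n K (cubeMs j) (jloc j)` ((2.20)), and `3^{d+1}√N c_K ≤ e^{−1}`
((2.21)–(2.22)).  Conclusion: for every fine site `x`, every set `P` with `|x/n − x′/n|_∞ ≥ D` on `P`, every source `f`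
supported in `P` with `|f| ≤ φ`: `|(G_k(Ω,A)f)(x)_i| ≤ 2^{d+2}e^{9/4}·max(√N c_G, 2)·e^{−D/K}·φ`.
[cite: Balaban1983RegularityDecay, Theorem (1.10) p.573; (2.2)/(2.6) pp.575–576, (2.12)–(2.13) p.577, (2.18)–(2.22) pp.578–579] -/
theorem thm110_value_boxCut (F : OrthFlow ι) (κ : ℝ) {ℓ k : ℕ} (hℓ : 1 ≤ ℓ) (hk : 1 ≤ k) (hn : 1 ≤ (ℓ + 1) ^ k)
    (hd : 1 ≤ d) (Mb : Fin (d + 1) → ℕ) (hMb : ∀ i, 1 ≤ Mb i) {K : ℕ} (hK8 : 8 ≤ K) (h4 : 4 ∣ K)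
    (hKM : ∀ μ, K ∣ Mb μ) {a m2 : ℝ} (ha : 0 < a) (hm : 0 ≤ m2)
    (A : ↥(Box d ℓ k Mb) → ↥(Box d ℓ k Mb) → ℝ)
    (At : (Fin (d + 1) → ℤ) → ↥(Box d ℓ k Mb) → ↥(Box d ℓ k Mb) → ℝ)
    (hplat : ∀ j (u v : ↥(Box d ℓ k Mb)), (∀ μ, |posR ℓ k Mb u μ - (K : ℝ) * j μ| ≤ 3 / 4 * (K : ℝ)) →
      (∀ μ, |posR ℓ k Mb v μ - (K : ℝ) * j μ| ≤ 3 / 4 * (K : ℝ)) → At j u v = A u v)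
    {cG cK : ℝ} (hcG : 0 ≤ cG) (hcK : 0 ≤ cK)
    (hG : ∀ j ∈ labelsK Mb K, ∀ Φ : ↥(Box d ℓ k (cubeMs Mb K j)) × ι → ℝ,
      supN (greenA d F κ ℓ k a m2 (cubeMs Mb K j) (baseEmb hn _) (stairContour hn _)
          (subField ℓ k Mb (cubeMs Mb K j) (cubeLo Mb K j) (cube_ho Mb K j) (At j)) *ᵥ Φ) ≤ cG * supN Φ)
    (hKG : ∀ j ∈ labelsK Mb K, ∀ Φ : ↥(Box d ℓ k (cubeMs Mb K j)) × ι → ℝ,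
      supN (kOp F κ ((ℓ + 1) ^ k) (B1.aSeq a ((ℓ : ℝ) + 1) k) m2 (cubeMs Mb K j) (baseEmb hn _) (stairContour hn _)
            (subField ℓ k Mb (cubeMs Mb K j) (cubeLo Mb K j) (cube_ho Mb K j) (At j))
            (hBox ((ℓ + 1) ^ k) K (cubeMs Mb K j) (jloc j))
          *ᵥ (greenA d F κ ℓ k a m2 (cubeMs Mb K j) (baseEmb hn _) (stairContour hn _)
              (subField ℓ k Mb (cubeMs Mb K j) (cubeLo Mb K j) (cube_ho Mb K j) (At j))
            *ᵥ (mulH (ι := ι) (hBox ((ℓ + 1) ^ k) K (cubeMs Mb K j) (jloc j)) *ᵥ Φ))) ≤ cK * supN Φ)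
    (h3 : (3 : ℝ) ^ (d + 1) * (Real.sqrt (Fintype.card ι) * cK) ≤ Real.exp (-1))
    (x : ↥(Box d ℓ k Mb)) (P : ↥(Box d ℓ k Mb) → Prop) [DecidablePred P] {D : ℝ}
    (hD : ∀ x', P x' → ∃ μ, D ≤ |posR ℓ k Mb x μ - posR ℓ k Mb x' μ|)
    (f : ↥(Box d ℓ k Mb) × ι → ℝ) (hfP : ∀ p, ¬ P p.1 → f p = 0) {φ : ℝ} (hφ : 0 ≤ φ) (hf : ∀ p, |f p| ≤ φ)
    (i : ι) :
    |(greenA d F κ ℓ k a m2 Mb (baseEmb hn Mb) (stairContour hn Mb) A *ᵥ f) (x, i)|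
      ≤ 2 ^ (d + 2) * Real.exp (9 / 4) * max (Real.sqrt (Fintype.card ι) * cG) 2 * Real.exp (-(D / K)) * φ := by
  have hK1 : 1 ≤ K := le_trans (by norm_num) hK8
  have hKr : (0 : ℝ) < K := by exact_mod_cast hK1
  have hn2 : ∀ i, 2 ≤ (ℓ + 1) ^ k * Mb i := fun i => by
    have h2 : 2 ≤ (ℓ + 1) ^ k := by
      calc 2 ≤ ℓ + 1 := by omega
        _ = (ℓ + 1) ^ 1 := (pow_one _).symm
        _ ≤ (ℓ + 1) ^ k := Nat.pow_le_pow_right (Nat.succ_pos ℓ) hk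
    nlinarith [hMb i]
  -- the per-cube propagators and their two norms
  have hγ : ∀ j : ↥(labelsK Mb K),
      ‖cubeGreen ℓ k Mb (cubeMs Mb K j.1) (cubeLo Mb K j.1) F κ (cube_ho Mb K j.1) hn a m2 (At j.1)‖
        ≤ max (Real.sqrt (Fintype.card ι) * cG) 2 := by
    intro j
    refine (norm_cubeGreen_le ℓ k Mb _ _ F κ (cube_ho Mb K j.1) hn a hm hd hn2 (At j.1)).trans ?_
    exact max_le_max (linfty_opNorm_le_of_supN _ hcG (hG j.1 j.2)) (two_div_sq_le hn)
  have main := ineq110_value_apply (X := ↥(Box d ℓ k Mb)) (Y := ↥(boxDom Mb)) (κ := ι) hKr (posR ℓ k Mb)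
    (boxWt ((ℓ + 1) ^ k) (fun i => (ℓ + 1) ^ k * Mb i)) m2
    (B1.aSeq a ((ℓ : ℝ) + 1) k * (((((ℓ + 1) ^ k : ℕ)) : ℝ) ^ (d + 1))⁻¹)
    (blkWt ((ℓ + 1) ^ k) Mb (fun i => (ℓ + 1) ^ k * Mb i)) (fieldLink F κ A)
    (contourTrans (fieldLink F κ A) (baseEmb hn Mb) (stairContour hn Mb))
    (fun _ _ h => boxWt_local hK8 h) (fun _ _ _ h h' => blkWt_local hK8 h h')
    (labelsK Mb K) (fun j z h => mem_labelsK_of_hCube_ne_zero hK1 hKM j z h)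
    (fun j => cubeS ℓ k Mb K j) (fun j z hz => cubeS_of_near hK1 j z hz)
    (fun j => cubeW ℓ k Mb (cubeMs Mb K j) (cubeLo Mb K j) F κ (At j))
    (fun j => cubeT ℓ k Mb (cubeMs Mb K j) (cubeLo Mb K j) F κ hn (At j))
    (fun j u v hu hv => by
      show (if inSub ℓ k Mb (cubeMs Mb K j) (cubeLo Mb K j) u ∧ inSub ℓ k Mb (cubeMs Mb K j) (cubeLo Mb K j) v
        then fieldLink F κ (At j) u v else 0) = fieldLink F κ A u v
      rw [if_pos ⟨cubeS_of_plateau hK1 j u hu, cubeS_of_plateau hK1 j v hv⟩]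
      show F.U (κ * At j u v) = F.U (κ * A u v)
      rw [hplat j u v hu hv])
    (fun j y u hq hu => by
      show (if inSub ℓ k Mb (cubeMs Mb K j) (cubeLo Mb K j) u then
        contourTrans (fieldLink F κ (At j)) (baseEmb hn Mb) (stairContour hn Mb) y u else 0)
        = contourTrans (fieldLink F κ A) (baseEmb hn Mb) (stairContour hn Mb) y u
      rw [if_pos (cubeS_of_plateau hK1 j u hu)]
      exact contourTrans_plateau F κ h4 hn (hplat j) hu hq)
    (fun j => cubeGreen ℓ k Mb (cubeMs Mb K j) (cubeLo Mb K j) F κ (cube_ho Mb K j) hn a m2 (At j))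
    (fun j _ => cubeOp_mul_cubeGreen ℓ k Mb _ _ F κ (cube_ho Mb K j) hℓ hk hn ha hm hd hn2 (At j))
    (greenA d F κ ℓ k a m2 Mb (baseEmb hn Mb) (stairContour hn Mb) A)
    (Matrix.nonsing_inv_mul _ (opA_stair_isUnit_det F κ hℓ hk hn ha hm Mb A))
    (γ := max (Real.sqrt (Fintype.card ι) * cG) 2) (β := Real.sqrt (Fintype.card ι) * cK)
    (le_max_of_le_right zero_le_two) hγ (by positivity)
    (fun j => by
      rw [cube_letter_b ℓ k Mb _ _ F κ (cube_ho Mb K j.1) hn a m2 (At j.1) _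
        (fun z hz => cubeS_of_hCube_ne_zero hK1 j.1 z hz), norm_pad (subEmb_injective ℓ k Mb _ _ _)]
      refine linfty_opNorm_le_of_supN _ hcK fun Φ => ?_
      have hh : (fun b : ↥(Box d ℓ k (cubeMs Mb K j.1)) =>
          hCube (K : ℝ) j.1 (posR ℓ k Mb (subEmb ℓ k Mb (cubeMs Mb K j.1) (cubeLo Mb K j.1) (cube_ho Mb K j.1) b)))
          = hBox ((ℓ + 1) ^ k) K (cubeMs Mb K j.1) (jloc j.1) :=
        funext fun b => hCube_subEmb hK1 hKM j.2 b
      rw [hh, ← Matrix.mulVec_mulVec, ← Matrix.mulVec_mulVec]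
      exact hKG j.1 j.2 Φ)
    h3 x P hD f hfP hφ hf i
  refine main.trans (le_of_eq ?_)
  ring

end Route

/-! ## §4. p35's cube configurations: restriction along `□_j`, and the theorem for the component field -/

section CubeField

variable {ι : Type} [Fintype ι] [DecidableEq ι]

omit [Fintype ι] [DecidableEq ι] in
/-- **p35's `Ã_j = A₀ + θ_j(A − A₀)` ON `Ω` RESTRICTS ALONG `□_j` TO THE CUBE CONFIGURATION `Ã_{jloc j}` OF THE
TRANSLATED COMPONENT FIELD** `A^{(j)}_ν(y) = A_ν(y + n·cubeLo j)` on the sub-box, same base value `A₀`.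
[cite: Balaban1983RegularityDecay, §2 p.575 «Ã_j = A₀ + θ_jA′»] -/
theorem subField_cubeField {ℓ k : ℕ} {Mb : Fin (d + 1) → ℕ} {K : ℕ} (hK : 1 ≤ K) (hKM : ∀ μ, K ∣ Mb μ)
    {j : Fin (d + 1) → ℤ} (hj : j ∈ labelsK Mb K) (A₀ : Fin (d + 1) → ℝ)
    (Ac : (Fin (d + 1) → ℤ) → Fin (d + 1) → ℝ) :
    subField ℓ k Mb (cubeMs Mb K j) (cubeLo Mb K j) (cube_ho Mb K j)
        (cubeField (Box d ℓ k Mb) ((ℓ + 1) ^ k) K j A₀ Ac)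
      = cubeField (Box d ℓ k (cubeMs Mb K j)) ((ℓ + 1) ^ k) K (jloc j) A₀
          (fun y => Ac (y + fun i => (((ℓ + 1) ^ k : ℕ) : ℤ) * (cubeLo Mb K j i : ℤ))) := by
  have hn : 1 ≤ (ℓ + 1) ^ k := Nat.one_le_pow _ _ (Nat.succ_pos ℓ)
  funext a b
  set e := subEmb ℓ k Mb (cubeMs Mb K j) (cubeLo Mb K j) (cube_ho Mb K j) with he
  have hea : ∀ c : ↥(Box d ℓ k (cubeMs Mb K j)),
      (e c).1 = c.1 + fun i => (((ℓ + 1) ^ k : ℕ) : ℤ) * (cubeLo Mb K j i : ℤ) := fun c => rfl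
  have hc : constBond A₀ Subtype.val (e a) (e b) = constBond A₀ Subtype.val a b :=
    constBond_add A₀ Subtype.val Subtype.val (fun i => (((ℓ + 1) ^ k : ℕ) : ℤ) * (cubeLo Mb K j i : ℤ)) e hea a b
  have hinf : (e a).1 ⊓ (e b).1 = (a.1 ⊓ b.1) + fun i => (((ℓ + 1) ^ k : ℕ) : ℤ) * (cubeLo Mb K j i : ℤ) := by
    funext i
    show min (a.1 i + _) (b.1 i + _) = min (a.1 i) (b.1 i) + _
    exact min_add_add_right _ _ _
  have hcf : compField Ac (e a).1 (e b).1
      = compField (fun y => Ac (y + fun i => (((ℓ + 1) ^ k : ℕ) : ℤ) * (cubeLo Mb K j i : ℤ))) a.1 b.1 := by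
    rw [hea a, hea b]; exact compField_add Ac a.1 b.1 _
  show cubeField (Box d ℓ k Mb) ((ℓ + 1) ^ k) K j A₀ Ac (e a) (e b) = _
  simp only [cubeField, Pi.add_apply, cubeFluct, fluct, hc, hinf, hcf,
    thetaZ_add hn hK (fun i => cubeLo_eq hKM hj i)]

/-- **THEOREM (1.10) ON A BOX WITH THE CUT CUBES, FOR THE COMPONENT FIELD `A` AND p35's `Ã_j = A₀ + θ_j(A − A₀)`**
(value member): `thm110_value_boxCut` with `A := compField Ac` and `Ã_j := cubeField Ω n K j (A₀ j) Ac`, an arbitrary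
base value `A₀ j` per label (print: «A₀ is a constant configuration, e.g. A₀ = A(Mj)»); plateau agreement = p35's
`cubeField_eq_compField`; the per-cube inputs are about the cube configuration `Ã_{jloc j}` of the translated component
field `A ∘ (· + n·cubeLo j)` on the sub-box `□_j` (`subField_cubeField`) — exactly the objects of p35's
`B4Eq220CubeField.lemma22_sup_cubeField` / `eq220_cubeField` on a box of sides `cubeMs j ≤ 2K`.
[cite: Balaban1983RegularityDecay, Theorem (1.10) p.573; §2 pp.575–579] -/
theorem thm110_value_boxCut_cubeField (F : OrthFlow ι) {ℓ k : ℕ} (hℓ : 1 ≤ ℓ) (hk : 1 ≤ k) (hn : 1 ≤ (ℓ + 1) ^ k)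
    (hd : 1 ≤ d) (Mb : Fin (d + 1) → ℕ) (hMb : ∀ i, 1 ≤ Mb i) {K : ℕ} (hK8 : 8 ≤ K) (h4 : 4 ∣ K)
    (hKM : ∀ μ, K ∣ Mb μ) {a m2 : ℝ} (ha : 0 < a) (hm : 0 ≤ m2) (e : ℝ)
    (Ac : (Fin (d + 1) → ℤ) → Fin (d + 1) → ℝ) (A₀ : (Fin (d + 1) → ℤ) → Fin (d + 1) → ℝ)
    {cG cK : ℝ} (hcG : 0 ≤ cG) (hcK : 0 ≤ cK)
    (hG : ∀ j ∈ labelsK Mb K, ∀ Φ : ↥(Box d ℓ k (cubeMs Mb K j)) × ι → ℝ,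
      supN (greenA d F (e / ((ℓ + 1) ^ k : ℕ)) ℓ k a m2 (cubeMs Mb K j) (baseEmb hn _) (stairContour hn _)
          (cubeField (Box d ℓ k (cubeMs Mb K j)) ((ℓ + 1) ^ k) K (jloc j) (A₀ j)
            (fun y => Ac (y + fun i => (((ℓ + 1) ^ k : ℕ) : ℤ) * (cubeLo Mb K j i : ℤ)))) *ᵥ Φ) ≤ cG * supN Φ)
    (hKG : ∀ j ∈ labelsK Mb K, ∀ Φ : ↥(Box d ℓ k (cubeMs Mb K j)) × ι → ℝ,
      supN (kOp F (e / ((ℓ + 1) ^ k : ℕ)) ((ℓ + 1) ^ k) (B1.aSeq a ((ℓ : ℝ) + 1) k) m2 (cubeMs Mb K j)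
            (baseEmb hn _) (stairContour hn _)
            (cubeField (Box d ℓ k (cubeMs Mb K j)) ((ℓ + 1) ^ k) K (jloc j) (A₀ j)
              (fun y => Ac (y + fun i => (((ℓ + 1) ^ k : ℕ) : ℤ) * (cubeLo Mb K j i : ℤ))))
            (hBox ((ℓ + 1) ^ k) K (cubeMs Mb K j) (jloc j))
          *ᵥ (greenA d F (e / ((ℓ + 1) ^ k : ℕ)) ℓ k a m2 (cubeMs Mb K j) (baseEmb hn _) (stairContour hn _)
              (cubeField (Box d ℓ k (cubeMs Mb K j)) ((ℓ + 1) ^ k) K (jloc j) (A₀ j)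
                (fun y => Ac (y + fun i => (((ℓ + 1) ^ k : ℕ) : ℤ) * (cubeLo Mb K j i : ℤ))))
            *ᵥ (mulH (ι := ι) (hBox ((ℓ + 1) ^ k) K (cubeMs Mb K j) (jloc j)) *ᵥ Φ))) ≤ cK * supN Φ)
    (h3 : (3 : ℝ) ^ (d + 1) * (Real.sqrt (Fintype.card ι) * cK) ≤ Real.exp (-1))
    (x : ↥(Box d ℓ k Mb)) (P : ↥(Box d ℓ k Mb) → Prop) [DecidablePred P] {D : ℝ}
    (hD : ∀ x', P x' → ∃ μ, D ≤ |posR ℓ k Mb x μ - posR ℓ k Mb x' μ|)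
    (f : ↥(Box d ℓ k Mb) × ι → ℝ) (hfP : ∀ p, ¬ P p.1 → f p = 0) {φ : ℝ} (hφ : 0 ≤ φ) (hf : ∀ p, |f p| ≤ φ)
    (i : ι) :
    |(greenA d F (e / ((ℓ + 1) ^ k : ℕ)) ℓ k a m2 Mb (baseEmb hn Mb) (stairContour hn Mb)
        (fun u v : ↥(Box d ℓ k Mb) => compField Ac u.1 v.1) *ᵥ f) (x, i)|
      ≤ 2 ^ (d + 2) * Real.exp (9 / 4) * max (Real.sqrt (Fintype.card ι) * cG) 2 * Real.exp (-(D / K)) * φ := by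
  have hK1 : 1 ≤ K := le_trans (by norm_num) hK8
  have hsub : ∀ j ∈ labelsK Mb K, subField ℓ k Mb (cubeMs Mb K j) (cubeLo Mb K j) (cube_ho Mb K j)
      (cubeField (Box d ℓ k Mb) ((ℓ + 1) ^ k) K j (A₀ j) Ac)
      = cubeField (Box d ℓ k (cubeMs Mb K j)) ((ℓ + 1) ^ k) K (jloc j) (A₀ j)
          (fun y => Ac (y + fun i => (((ℓ + 1) ^ k : ℕ) : ℤ) * (cubeLo Mb K j i : ℤ))) :=
    fun j hj => subField_cubeField hK1 hKM hj (A₀ j) Ac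
  refine thm110_value_boxCut F (e / ((ℓ + 1) ^ k : ℕ)) hℓ hk hn hd Mb hMb hK8 h4 hKM ha hm
    (fun u v : ↥(Box d ℓ k Mb) => compField Ac u.1 v.1)
    (fun j => cubeField (Box d ℓ k Mb) ((ℓ + 1) ^ k) K j (A₀ j) Ac)
    (fun j u v hu hv => cubeField_eq_compField hn hK1 j (A₀ j) Ac (fun μ => plateau_fine hu μ)
      (fun μ => plateau_fine hv μ))
    hcG hcK (fun j hj Φ => ?_) (fun j hj Φ => ?_) h3 x P hD f hfP hφ hf i
  · rw [hsub j hj]; exact hG j hj Φ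
  · rw [hsub j hj]; exact hKG j hj Φ

end CubeField

end

end Literature.MathematicalPhysics.QuantumFieldTheory.Balaban1983to89.B4Thm110BoxCut
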